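import Literature.Topology.Immersions.OpenParallelizableImmersionChart
import Literature.Topology.Immersions.HolonomicExtensionCore
import HarnessLib

/-!
# Open parallelizable manifolds immerse in `ℝⁿ`: extending a formal submersion over a core in a chart

Topic `Literature/Topology/Immersions`; the **handle step** of the induction proving the named
fact `Literature.Topology.Immersions.Phillips1967_exists_isLocalDiffeomorph_of_isParallelizable`
(Phillips 1967, Cor. 8.2, "if"), in the formal-solution language of
`OpenParallelizableImmersionInduction.lean`, with the analytic input abstracted as in
`HolonomicExtensionCore.lean`. Let `(f, Ψ)` be a formal submersion of the framed manifold `Mⁿ⁺²`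
holonomic near the closed set `U`, `e` a chart of the maximal `C^∞` atlas whose target contains a
closed tube about a compact core `C ⊂ ℝⁿ⁺²` with attaching part `B ⊆ C`, such that `e⁻¹(B) ⊆ U`
and `e⁻¹(C)` meets `U` only along `e⁻¹(B)` (the core of a handle attached to `U`), and assume the
relative holonomic approximation property of `(C, B)` (`IsRelHolApprox`). Then `(f, Ψ)` can be
modified inside `e⁻¹`(tube) into a formal submersion holonomic near `U ∪ e⁻¹(C)`.

Proof: read `(f, Ψ)` in the chart (`chartDeriv`, `OpenParallelizableImmersionChart.lean`),
extend the Euclidean formal submersion over the core (`exists_holonomic_extension_core`), and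
push the result back through `e`, extending by zero off the chart.

* `Literature.Topology.Immersions.HolonomicNear.core` — the handle step for an abstract core.

## References

* A. Phillips, *Submersions of open manifolds*, Topology **6** (1967), Lemma 4.1, §6.
  [Phillips1967]
* Y. Eliashberg, N. Mishachev, *Holonomic approximation and Gromov's h-principle*,
  arXiv:math/0101196 (2001), §2.1, Thm. 1.3.1. [EliashbergMishachev2001]
-/

open scoped Manifold ContDiff Topology
open Set Function Filter Bundle Module Metric

noncomputable section

namespace Literature.Topology.Immersions

variable {n : ℕ} {M : Type*} [TopologicalSpace M]
  [ChartedSpace (EuclideanSpace ℝ (Fin (n + 2))) M] [IsManifold (𝓡 (n + 2)) ∞ M] [T2Space M]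

/-- Local notation: the model space `ℝⁿ⁺²`. -/
local notation "𝔼₂" => EuclideanSpace ℝ (Fin (n + 2))

open Classical in
/-- **The handle step over an abstract core** (Phillips 1967, Lemma 4.1, in the formal-solution
language; Eliashberg–Mishachev 2001, §2.1). Let `σ` be a continuous frame of the `C^∞` manifold
`M` (Hausdorff, modelled on `ℝⁿ⁺²`), `(f, Ψ)` a formal submersion holonomic near a set `U'`,
`U ⊆ U'` closed (the part to which the core is attached), `e` a chart of the maximal `C^∞` atlas
whose target contains the closed `ρ`-tube of the compact core `C`, `B` a set ("attaching
region") containing every `y ∈ C` with `e⁻¹(y) ∈ U`, and suppose `(C, B)` has the relative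
holonomic approximation property for sections holonomic on open sets containing the points
`y ∈ C` with `e⁻¹(y) ∈ U'` (so cube theorems relative to a fixed collar apply when `U'` is
larger than `U`). Then there is
a formal submersion `(g, Ψ')` holonomic near `U ∪ e⁻¹(C)` which agrees with `(f, Ψ)` at every
`x` with `x ∉ e.source` or `e x ∉` the open `ρ`-tube of `C`. [cite: Phillips1967, Lemma 4.1 and §6] -/
theorem HolonomicNear.core {σ : Fin (n + 2) → M → 𝔼₂}
    (hσ : ∀ i, Continuous fun x => (⟨x, σ i x⟩ : TangentBundle (𝓡 (n + 2)) M))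
    (hli : ∀ x, LinearIndependent ℝ fun i => σ i x) {f : M → 𝔼₂} {Ψ : M → Fin (n + 2) → 𝔼₂}
    {U' : Set M} (h : HolonomicNear σ f Ψ U') {U : Set M} (hU : IsClosed U) (hUU' : U ⊆ U')
    {e : OpenPartialHomeomorph M 𝔼₂} (he : e ∈ IsManifold.maximalAtlas (𝓡 (n + 2)) ∞ M)
    {C B : Set 𝔼₂} (hCc : IsCompact C)
    {ρ : ℝ} (hρ : 0 < ρ) (hρe : cthickening ρ C ⊆ e.target)
    (hUC : ∀ y ∈ C, e.symm y ∈ U → y ∈ B)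
    (happrox : ∀ (F₀ : 𝔼₂ → 𝔼₂) (F₁ : 𝔼₂ → 𝔼₂ →L[ℝ] 𝔼₂) (φ₀ : 𝔼₂ → 𝔼₂) (O' : Set 𝔼₂)
      (ε δ : ℝ), Continuous F₀ → Continuous F₁ → ContDiff ℝ ∞ φ₀ → IsOpen O' →
      (∀ y ∈ C, e.symm y ∈ U' → y ∈ O') →
      (∀ x ∈ O', φ₀ x = F₀ x ∧ fderiv ℝ φ₀ x = F₁ x) → 0 < ε → 0 < δ →
      ∃ (H : ℝ → 𝔼₂ → 𝔼₂) (E' Ω : Set 𝔼₂) (g : 𝔼₂ → 𝔼₂),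
        IsRelHolApprox C B O' F₀ F₁ φ₀ ε δ H E' Ω g) :
    ∃ (g : M → 𝔼₂) (Ψ' : M → Fin (n + 2) → 𝔼₂),
      HolonomicNear σ g Ψ' (U ∪ e.symm '' C) ∧
      ∀ x, (x ∈ e.source → e x ∉ thickening ρ C) → g x = f x ∧ Ψ' x = Ψ x := by
  obtain ⟨V, hV, hUV, hVeq⟩ := h.exists_isOpen
  -- tubes
  have hT34 : cthickening (3 * ρ / 4) C ⊆ e.target := (cthickening_mono (by linarith) C).trans hρe
  have hT2 : cthickening (ρ / 2) C ⊆ e.target := (cthickening_mono (by linarith) C).trans hρe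
  have hT4 : cthickening (ρ / 4) C ⊆ e.target := (cthickening_mono (by linarith) C).trans hρe
  -- the map read in the chart, cut off: `f_E = χ • (f ∘ e⁻¹)`
  obtain ⟨χ, hχs, hχ0, hχ1, hχ01⟩ := exists_contDiff_zero_one_of_isClosed (n := n)
    (isOpen_thickening (δ := ρ) (E := C)).isClosed_compl
    (isClosed_cthickening (δ := 3 * ρ / 4) (E := C))
    (disjoint_compl_left_iff_subset.2
      (cthickening_subset_thickening' hρ (by linarith : 3 * ρ / 4 < ρ) C))
  have hχsupp : tsupport χ ⊆ cthickening ρ C := by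
    refine closure_minimal (fun y hy => ?_) isClosed_cthickening
    by_contra hy'
    exact hy (hχ0 fun h' => hy' (thickening_subset_cthickening _ _ h'))
  set fE : 𝔼₂ → 𝔼₂ := fun y => χ y • f (e.symm y) with hfE
  have hfsymm : ContMDiffOn (𝓡 (n + 2)) (𝓡 (n + 2)) ∞ (fun y => f (e.symm y)) e.target :=
    h.contMDiff.comp_contMDiffOn (contMDiffOn_symm_of_mem_maximalAtlas he)
  have hfsymm' : ContDiffOn ℝ ∞ (fun y => f (e.symm y)) e.target :=
    contMDiffOn_iff_contDiffOn.1 hfsymm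
  have hfE_smooth : ContDiff ℝ ∞ fE := by
    rw [contDiff_iff_contDiffAt]
    intro y
    by_cases hy : y ∈ e.target
    · exact (hχs.contDiffAt.smul (hfsymm'.contDiffAt (e.open_target.mem_nhds hy)))
    · have hyχ : y ∉ tsupport χ := fun h' => hy (hρe (hχsupp h'))
      have hev : fE =ᶠ[𝓝 y] fun _ => 0 := by
        filter_upwards [(isClosed_tsupport χ).isOpen_compl.mem_nhds hyχ] with z hz
        simp [hfE, image_eq_zero_of_notMem_tsupport hz]
      exact contDiffAt_const.congr_of_eventuallyEq hev
  have hfE_eq : ∀ y ∈ cthickening (3 * ρ / 4) C, fE y = f (e.symm y) := fun y hy => by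
    simp [hfE, hχ1 hy]
  -- the formal derivative read in the chart
  set Ah : 𝔼₂ → 𝔼₂ →L[ℝ] 𝔼₂ := chartDeriv σ e Ψ with hAh
  set O : Set 𝔼₂ := e.target ∩ thickening (3 * ρ / 4) C with hO
  have hO_open : IsOpen O := e.open_target.inter isOpen_thickening
  have hAh_cont : ContinuousOn Ah O := (continuousOn_chartDeriv he hσ hli h.continuous).mono
    inter_subset_left
  have hAh_inv : ∀ y ∈ O, (Ah y).IsInvertible := fun y hy =>
    isInvertible_chartDeriv he hli h.linearIndependent hy.1
  -- the Euclidean holonomic region `W_E` and closed set `U_E`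
  set WE : Set 𝔼₂ := (e.target ∩ e.symm ⁻¹' V) ∩ thickening (3 * ρ / 4) C with hWE
  have hWE_open : IsOpen WE := (e.symm.isOpen_inter_preimage hV).inter isOpen_thickening
  have hWEO : WE ⊆ O := fun y hy => ⟨hy.1.1, hy.2⟩
  set UE : Set 𝔼₂ := cthickening (ρ / 2) C ∩ e.symm ⁻¹' U with hUE
  have hUE_closed : IsClosed UE :=
    (e.continuousOn_symm.mono hT2).preimage_isClosed_of_isClosed isClosed_cthickening hU
  have hUEWE : UE ⊆ WE := fun y hy =>
    ⟨⟨hT2 hy.1, hUV (hUU' hy.2)⟩, cthickening_subset_thickening' (by positivity) (by linarith) C hy.1⟩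
  have hholE : ∀ y ∈ WE, fderiv ℝ fE y = Ah y := by
    intro y hy
    have hyt : y ∈ e.target := hy.1.1
    have hx : e.symm y ∈ e.source := e.map_target hyt
    have hev : fE =ᶠ[𝓝 y] fun z => f (e.symm z) := by
      filter_upwards [isOpen_thickening.mem_nhds hy.2] with z hz
      exact hfE_eq z (thickening_subset_cthickening _ _ hz)
    rw [hev.fderiv_eq]
    have key := chartDeriv_eq_fderiv_of_eq (Ψ := Ψ) he hli hx
      (h.contMDiff.mdifferentiableAt (by simp)) (hVeq _ hy.1.2)
    rw [e.right_inv hyt] at key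
    exact key.symm
  -- apply the Euclidean extension lemma with tube parameter `ρ / 4`
  have hρ4O : cthickening (ρ / 4) C ⊆ O := fun y hy =>
    ⟨hT4 hy, cthickening_subset_thickening' (by positivity) (by linarith) C hy⟩
  have hUEC : UE ∩ C ⊆ B := fun y hy => hUC y hy.2 hy.1.2
  obtain ⟨gE, A', W', hgE, hA'c, hA'inv, hW', hUCW', hW'O, hholW', hoff⟩ :=
    exists_holonomic_extension_core hO_open hfE_smooth hAh_cont hAh_inv hUE_closed hWE_open
      hUEWE hWEO hholE hCc (ρ := ρ / 4) (by positivity) hρ4O hUEC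
      (fun F₀ F₁ φ₀ O' ε δ h₀ h₁ hφ₀ hO' hWC hhol' hε hδ =>
        happrox F₀ F₁ φ₀ O' ε δ h₀ h₁ hφ₀ hO'
          (fun y hyC hyU' => hWC ⟨⟨⟨hρe (self_subset_cthickening C hyC), hUV hyU'⟩,
            self_subset_thickening (by positivity) C hyC⟩, hyC⟩) hhol' hε hδ)
  -- push forward through the chart
  set d : 𝔼₂ → 𝔼₂ := fun y => gE y - fE y with hd
  have hd_smooth : ContDiff ℝ ∞ d := hgE.sub hfE_smooth
  have hd_zero : ∀ y ∉ thickening (ρ / 4) C, d y = 0 := fun y hy => by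
    simp [hd, (hoff y hy).1]
  have hd_supp : tsupport d ⊆ cthickening (ρ / 4) C := by
    refine closure_minimal (fun y hy => ?_) isClosed_cthickening
    by_contra hy'
    exact hy (hd_zero y fun h' => hy' (thickening_subset_cthickening _ _ h'))
  set D : M → 𝔼₂ := fun x => if x ∈ e.source then d (e x) else 0 with hD
  have hD_smooth : ContMDiff (𝓡 (n + 2)) (𝓡 (n + 2)) ∞ D :=
    contMDiff_extend_comp_chart he hd_smooth (hCc.cthickening) hT4 hd_supp
  set g : M → 𝔼₂ := fun x => f x + D x with hg
  set Ψ' : M → Fin (n + 2) → 𝔼₂ := fun x =>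
    if x ∈ e.source ∧ e x ∈ O then (fun i => A' (e x) (frameDeriv σ e x i)) else Ψ x with hΨ'
  -- the region where the modification lives, closed in `M`
  set Kc : Set M := e.symm '' cthickening (ρ / 4) C with hKc
  have hKc_closed : IsClosed Kc :=
    ((hCc.cthickening).image_of_continuousOn (e.continuousOn_symm.mono hT4)).isClosed
  have hnotKc : ∀ x ∉ Kc, x ∈ e.source → e x ∉ cthickening (ρ / 4) C := fun x hx hxs hex =>
    hx ⟨e x, hex, e.left_inv hxs⟩
  -- where nothing changes
  have hg_of : ∀ x, (x ∈ e.source → e x ∉ thickening (ρ / 4) C) → g x = f x := by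
    intro x hx
    by_cases hxs : x ∈ e.source
    · simp [hg, hD, hxs, hd_zero _ (hx hxs)]
    · simp [hg, hD, hxs]
  have hΨ'_of : ∀ x, (x ∈ e.source → e x ∉ thickening (ρ / 4) C) → Ψ' x = Ψ x := by
    intro x hx
    by_cases hxO : x ∈ e.source ∧ e x ∈ O
    · simp only [hΨ', hxO, and_self, if_true]
      funext i
      rw [(hoff (e x) (hx hxO.1)).2]
      exact chartDeriv_apply_frameDeriv he hli hxO.1 i
    · simp only [hΨ', hxO, if_false]
  have hZg : ∀ x ∉ Kc, g x = f x := fun x hx =>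
    hg_of x fun hxs hex => hnotKc x hx hxs (thickening_subset_cthickening _ _ hex)
  have hZΨ : ∀ x ∉ Kc, Ψ' x = Ψ x := fun x hx =>
    hΨ'_of x fun hxs hex => hnotKc x hx hxs (thickening_subset_cthickening _ _ hex)
  refine ⟨g, Ψ', ?_, fun x hx => ⟨hg_of x fun hxs hex => hx hxs (thickening_mono (by linarith) C hex),
    hΨ'_of x fun hxs hex => hx hxs (thickening_mono (by linarith) C hex)⟩⟩
  -- on the source, near `O`, `g = gE ∘ e`
  have hP1_open : IsOpen (e.source ∩ e ⁻¹' O) := e.isOpen_inter_preimage hO_open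
  have hg_eq : ∀ x ∈ e.source ∩ e ⁻¹' O, g x = gE (e x) := by
    rintro x ⟨hxs, hxO⟩
    have hfEx : fE (e x) = f x := by
      rw [hfE_eq _ (thickening_subset_cthickening _ _ hxO.2), e.left_inv hxs]
    simp only [hg, hD, hxs, if_true, hd]
    rw [hfEx]
    abel
  -- the holonomy region `R = (e.source ∩ e ⁻¹' W') ∪ (V ∩ Kcᶜ)`
  have hR1_open : IsOpen (e.source ∩ e ⁻¹' W') := e.isOpen_inter_preimage hW'
  have hg_smooth : ContMDiff (𝓡 (n + 2)) (𝓡 (n + 2)) ∞ g := h.contMDiff.add hD_smooth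
  refine (HolonomicNear.of_isOpen (U := (e.source ∩ e ⁻¹' W') ∪ (V ∩ Kcᶜ))
    (hR1_open.union (hV.inter hKc_closed.isOpen_compl)) hg_smooth ?_ ?_ ?_).mono ?_
  · -- continuity of `Ψ'`
    have hS := continuousOn_frameDeriv_chart (σ := σ) he hσ
    have h_on : ContinuousOn Ψ' (e.source ∩ e ⁻¹' O) := by
      have h' : ContinuousOn (fun x => fun i => A' (e x) (frameDeriv σ e x i))
          (e.source ∩ e ⁻¹' O) := by
        refine continuousOn_pi.2 fun i => ?_
        have hAe : ContinuousOn (fun x => A' (e x)) (e.source ∩ e ⁻¹' O) :=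
          hA'c.comp (e.continuousOn.mono inter_subset_left) fun x hx => hx.2
        exact hAe.clm_apply (((continuousOn_pi.1 hS) i).mono inter_subset_left)
      exact h'.congr fun x hx => by
        have hxO : e x ∈ O := hx.2
        simp only [hΨ', hx.1, hxO, and_self, if_true]
    have h_off : ContinuousOn Ψ' Kcᶜ := h.continuous.continuousOn.congr fun x hx => hZΨ x hx
    have hunion : (e.source ∩ e ⁻¹' O) ∪ Kcᶜ = univ := by
      refine eq_univ_of_forall fun x => ?_
      by_cases hx : x ∈ Kc
      · obtain ⟨y, hy, rfl⟩ := hx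
        exact Or.inl ⟨e.map_target (hT4 hy), by rw [mem_preimage, e.right_inv (hT4 hy)]; exact hρ4O hy⟩
      · exact Or.inr hx
    rw [← continuousOn_univ, ← hunion]
    exact h_on.union_of_isOpen h_off hP1_open hKc_closed.isOpen_compl
  · -- linear independence
    intro x
    by_cases hxO : x ∈ e.source ∧ e x ∈ O
    · simp only [hΨ', hxO, and_self, if_true]
      obtain ⟨L, hL⟩ := hA'inv (e x) hxO.2
      have key : LinearIndependent ℝ (L.toLinearEquiv ∘ frameDeriv σ e x) :=
        (linearIndependent_frameDeriv_chart he hli hxO.1).map' L.toLinearEquiv.toLinearMap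
          L.toLinearEquiv.ker
      have hfun : (fun i => A' (e x) (frameDeriv σ e x i)) = L.toLinearEquiv ∘ frameDeriv σ e x := by
        funext i
        simp only [comp_apply, ← hL]
        rfl
      rw [hfun]
      exact key
    · simp only [hΨ', hxO, if_false]
      exact h.linearIndependent x
  · -- holonomy on the region
    rintro x (⟨hxs, hxW'⟩ | ⟨hxV, hxK⟩)
    · have hxO : e x ∈ O := hW'O hxW'
      have hΨ'x : Ψ' x = fun i => A' (e x) (frameDeriv σ e x i) := by
        simp only [hΨ', hxs, hxO, and_self, if_true]
      rw [hΨ'x]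
      have hgev : g =ᶠ[𝓝 x] fun z => gE (e z) := by
        filter_upwards [hP1_open.mem_nhds ⟨hxs, hxO⟩] with z hz
        exact hg_eq z hz
      rw [frameDeriv_congr_of_eventuallyEq hgev]
      funext i
      rw [frameDeriv_comp_chart he hxs ((hgE.differentiable (by simp)) (e x)) i, hholW' _ hxW']
    · have hgev : g =ᶠ[𝓝 x] f := by
        filter_upwards [hKc_closed.isOpen_compl.mem_nhds hxK] with z hz
        exact hZg z hz
      rw [hZΨ x hxK, frameDeriv_congr_of_eventuallyEq hgev]
      exact hVeq x hxV
  · -- `U ∪ e⁻¹(C) ⊆ R`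
    rintro x (hxU | ⟨y, hyC, rfl⟩)
    · by_cases hxK : x ∈ Kc
      · obtain ⟨y, hy, rfl⟩ := hxK
        have hyUE : y ∈ UE := ⟨cthickening_mono (by linarith) C hy, hxU⟩
        refine Or.inl ⟨e.map_target (hT4 hy), ?_⟩
        rw [mem_preimage, e.right_inv (hT4 hy)]
        exact hUCW' (Or.inl hyUE)
      · exact Or.inr ⟨hUV (hUU' hxU), hxK⟩
    · have hyt : y ∈ e.target := hT4 (self_subset_cthickening C hyC)
      refine Or.inl ⟨e.map_target hyt, ?_⟩
      rw [mem_preimage, e.right_inv hyt]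
      exact hUCW' (Or.inr hyC)

end Literature.Topology.Immersions
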